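import Literature.MathematicalPhysics.StatisticalMechanics.WulffHexagonRiemannSums
import Literature.MathematicalPhysics.StatisticalMechanics.TriangularLatticeMaximalHexagon
import HarnessLib

/-!
# Davoli–Piovano–Stefanelli 2017, Theorem 1.2 PROVED: EIP minimizers on the triangular lattice
# converge to the Wulff hexagon, with the sharp `N^{3/4}` law and the flat-norm rate `2K_t n^{−1/4}`;
# Schmidt 2013 Theorem 2.4 and Au Yeung–Friesecke–Schmidt 2012 Theorem 1.2 PROVED as corollaries

Topic `Literature/MathematicalPhysics/StatisticalMechanics`; sequel to
`TriangularLatticeEdgeIsoperimetry.lean` (the named fact `DavoliPiovanoStefanelli2017_wulffShape`),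
`TriangularLatticeMaximalHexagon.lean` (Proposition 3.7, Corollary 1.3 and the `N^{3/4}` law
`n − #H_{r(M_n)} ≤ K_t n^{3/4} + 6√n + 5` — clause (15) — proved) and `WulffHexagonRiemannSums.lean`
(lattice coordinates, cells, `tendsto_hexagon_riemann_sum`).  Cell `crystal3d-full`, literature-typing
layer D-0088 (4), seat `littype-FC1-1` (gen 10).  This file DISCHARGES
`DavoliPiovanoStefanelli2017_wulffShape` (`theorem DavoliPiovanoStefanelli2017_wulffShape_holds`);
with it every named fact of `TriangularLatticeEdgeIsoperimetry.lean` is a theorem.  No new named facts.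

## Source, as printed

[DavoliPiovanoStefanelli2017] E. Davoli, P. Piovano, U. Stefanelli, J. Nonlinear Sci. **27** (2017)
627–660, Theorem 1.2 (p. 632): for minimizers `M_n` of the edge-isoperimetric problem on `𝓛_t`,
"`μ_{M_n} ⇀* (2/√3) χ_W` weakly* in the sense of measures … (up to translations)", `W :=
conv{±t₁/√3, ±t₂/√3, ±(t₂ − t₁)/√3}`; (15) `|M_n ∖ H_{r_{M_n}}| ≤ K_t n^{3/4} + o(n^{3/4})`; (18)
`‖μ_{M_n} − (2/√3)χ_W‖_F ≤ 2K_t n^{−1/4} + o(n^{−1/4})` in the flat norm (17), `K_t = 2/3^{1/4}` (19).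
Proof §4.1 (p. 653–655): Step 1 = (15) from Proposition 3.7; Step 2: the maximal hexagons
`H_{r_{M_n}}` translated to the origin and re-scaled by `√n` converge to `W` because
`r_{M_n}/√n → 1/√3`, and `|M_n ∖ H_{r_{M_n}}|/n → 0`; Step 3 (79)–(80): for a 1-Lipschitz `φ` with
`|φ| ≤ 1`, `|∫ φ dμ_{M_n} − (2/√3)∫_W φ| ≤ |M_n ∖ H_{r_{M_n}}|/n + (2/√3)|W ∖ (√n)⁻¹H_{r_{M_n}}| + O(n^{−1/2})
≤ 2K_t n^{−1/4} + o(n^{−1/4})`.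

## The proof formalised (translations `a_n := −q_n`, `q_n` the centre of a maximal hexagon)

§1: `∫ g dμ_{M_n − q_n} = n⁻¹ Σ_{v ∈ H_{r_n}} g(triPoint v/√n) + n⁻¹ Σ_{x ∈ M_n ∖ (H_{r_n}+q_n)} g((x−q_n)/√n)`
(`setEmpiricalIntegral_split`); the second sum is `≤ ‖g‖_∞ (K_t n^{3/4} + 6√n + 5)/n → 0`; the first
converges to `(2/√3)∫_W g` by `tendsto_hexagon_riemann_sum`, since `r_n/√n → 1/√3`
(`tendsto_maxHexRadius_div_sqrt`, from `#H_{r_n} ≤ n` and the `N^{3/4}` law).  §2: for `φ`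
1-Lipschitz with `|φ| ≤ 1` and `n ≥ 13` (`flat_estimate`): remainder `≤ E_n/n`
(`E_n = K_t n^{3/4} + 6√n + 5`), Riemann error on the cells `≤ 2/√n`, and
`(2/√3)|∫_{U_n} φ − ∫_W φ| ≤ (2/√3)(|U_n ∖ W| + |W ∖ U_n|)` with `W ∖ U_n` covered by the cells of the
shell `H_R ∖ H_{r_n}`, `R = ⌊√n/√3⌋ + 3` (`#≤ E_n + 7√3√n + 37` cells, `wulffHexagon_diff_subset`,
`card_outer_shell_le`) and `U_n ∖ W` by those of `H_{r_n} ∖ H_{r_n − 3}` (`≤ 18 r_n + 19` cells),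
each of area `(√3/2)/n`; total `≤ (2E_n + (7√3+18)√n + 56)/n + 2/√n ≤ (2K_t + δ) n^{−1/4}`
eventually (`flatNorm_le`, `eventually_flatNorm_le`).  Clause (15) is
`eventually_card_sub_card_maxHexagon_le` of `TriangularLatticeMaximalHexagon.lean`.
§3 `DavoliPiovanoStefanelli2017_wulffShape_holds`; `flatBound_le` (the bound in closed form
`≤ (2K_t + 113) n^{−1/4}`).  §4 (namespace `…Schmidt2013`) **Schmidt 2013, Theorem 2.4 PROVED**:
`Schmidt2013_deviationUpperBound_holds` (`C = 2K_t + 113`, `N₀ = 13`) — a sticky-disc ground state on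
the lattice is an EIP minimizer (`isTriMinimizer_of_isMaximalDiscConfig`) and
`empiricalIntegral = setEmpiricalIntegral` of the centre set.  §5 (namespace
`…AuYeungFrieseckeSchmidt2012`) **Au Yeung–Friesecke–Schmidt 2012, Theorem 1.2 PROVED**:
`AuYeungFrieseckeSchmidt2012_wulffShape_holds` — a crystallized ground state of a potential with
(H1)–(H3) is an EIP minimizer after the rigid motion of Definition 1.1
(`isTriMinimizer_of_isGroundState`, comparison with the hexagonal spiral through `energy_triPoint_eq`),
then `weakStar_wulffHexagon`; corollary `wulffShape_stickyPotential_holds` (the Heitmann–Radin sticky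
disc crystallizes in the Wulff shape, unconditionally).
[cite: Schmidt2013, Theorem 2.4 (p0007)] [cite: AuYeungFrieseckeSchmidt2012, Theorem 1.2 (p0004); §5 (p0012)]
-/

noncomputable section

open Set MeasureTheory Filter Metric Finset
open scoped Topology Pointwise

/-! ## §1 Theorem 1.2, first clause: EIP minimizers converge weak* to the Wulff hexagon -/

namespace Literature.MathematicalPhysics.StatisticalMechanics.DavoliPiovanoStefanelli2017

open AuYeungFrieseckeSchmidt2012 (wulffHexagon tendsto_hexagon_riemann_sum)
open Theil2006 (Plane triPoint triangularLattice triPoint_injective)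
open Literature.Geometry.DiscreteGeometry.HarborthSpiral (hexagon)

/-- A continuous function tending to `0` at infinity is bounded. [folklore] -/
private theorem exists_bound_of_tendsto_cocompact' {g : Plane → ℝ} (hg : Continuous g)
    (h0 : Tendsto g (cocompact Plane) (𝓝 0)) : ∃ B : ℝ, 0 ≤ B ∧ ∀ y, |g y| ≤ B := by
  have h1 : ∀ᶠ y in cocompact Plane, dist (g y) 0 < 1 := Metric.tendsto_nhds.1 h0 1 one_pos
  obtain ⟨K, hK, hKc⟩ := Filter.mem_cocompact.1 h1
  obtain ⟨C, hC⟩ := hK.exists_bound_of_continuousOn hg.continuousOn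
  refine ⟨max C 1, le_max_of_le_right zero_le_one, fun y => ?_⟩
  by_cases hy : y ∈ K
  · have := hC y hy
    rw [Real.norm_eq_abs] at this
    exact this.trans (le_max_left _ _)
  · have := hKc hy
    simp only [Set.mem_setOf_eq, dist_zero_right, Real.norm_eq_abs] at this
    exact this.le.trans (le_max_right _ _)

/-- **A minimizer contains a hexagonal configuration of maximal radius centred at a lattice point.**
[cite: DavoliPiovanoStefanelli2017, (55) p. 641; Corollary 1.3 p. 633] -/
theorem exists_hexConfig_maxHexRadius_subset {M : Finset Plane} (hM : M.Nonempty)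
    (hmin : IsTriMinimizer M) : ∃ q ∈ triangularLattice, hexConfig (maxHexRadius M) q ⊆ ↑M := by
  obtain ⟨C, hC⟩ := DavoliPiovanoStefanelli2017_hausdorff_holds
  obtain ⟨q, hq, h, -⟩ := hC M hM hmin
  exact ⟨q, hq, h⟩

/-- The hexagonal configuration `H_s + q` as a finset: the image of the label hexagon.
[cite: DavoliPiovanoStefanelli2017, (54) p. 641] -/
theorem coe_image_hexagon (s : ℕ) (q : Plane) :
    (↑((hexagon s).image fun v => triPoint v + q) : Set Plane) = hexConfig s q := by
  unfold hexConfig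
  rw [Finset.coe_image, Set.image_image]

/-- `#(H_s + q) = #H_s = 3s² + 3s + 1`. [cite: DavoliPiovanoStefanelli2017, (15) p. 632 ("`1 + 3r + 3r²`")] -/
theorem card_image_hexagon (s : ℕ) (q : Plane) :
    ((hexagon s).image fun v => triPoint v + q).card = (hexagon s).card :=
  Finset.card_image_of_injective _ fun _ _ h => triPoint_injective (add_right_cancel h)

/-- **`#H_{r(M)} ≤ #M`**: the maximal hexagon fits. [cite: DavoliPiovanoStefanelli2017, (55) p. 641] -/
theorem card_hexagon_maxHexRadius_le {M : Finset Plane} (hM : M.Nonempty) (hmin : IsTriMinimizer M) :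
    (hexagon (maxHexRadius M)).card ≤ M.card := by
  obtain ⟨q, -, h⟩ := exists_hexConfig_maxHexRadius_subset hM hmin
  rw [← card_image_hexagon _ q]
  exact Finset.card_le_card (Finset.coe_subset.1 ((coe_image_hexagon _ q).symm ▸ h))

open Classical in
/-- **The centre of a maximal hexagon of `M`** (a lattice point `q` with `H_{r(M)} + q ⊆ M`, chosen
once and for all; `0` if `M` is empty or not a minimizer). [cite: DavoliPiovanoStefanelli2017, (55) p. 641] -/
def hexCenter (M : Finset Plane) : Plane :=
  if h : M.Nonempty ∧ IsTriMinimizer M then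
    Classical.choose (exists_hexConfig_maxHexRadius_subset h.1 h.2) else 0

/-- The defining property of `hexCenter`. [cite: DavoliPiovanoStefanelli2017, (55) p. 641] -/
theorem hexConfig_hexCenter_subset {M : Finset Plane} (hM : M.Nonempty) (hmin : IsTriMinimizer M) :
    hexConfig (maxHexRadius M) (hexCenter M) ⊆ ↑M := by
  have h : M.Nonempty ∧ IsTriMinimizer M := ⟨hM, hmin⟩
  unfold hexCenter
  rw [dif_pos h]
  exact (Classical.choose_spec (exists_hexConfig_maxHexRadius_subset h.1 h.2)).2

/-- The lower-order terms of the `N^{3/4}` law are `o(n)`: `(K_t n^{3/4} + 6√n + 5)/n → 0`.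
[cite: DavoliPiovanoStefanelli2017, (15) p. 632] -/
theorem tendsto_errorTerm_div :
    Tendsto (fun n : ℕ => (sharpConstant * (n : ℝ) ^ (3 / 4 : ℝ) + 6 * Real.sqrt n + 5) / n)
      atTop (𝓝 0) := by
  have hsq : Tendsto (fun n : ℕ => Real.sqrt n) atTop atTop :=
    Real.tendsto_sqrt_atTop.comp tendsto_natCast_atTop_atTop
  have h1 : Tendsto (fun n : ℕ => (n : ℝ) ^ (-(1 / 4 : ℝ))) atTop (𝓝 0) :=
    (tendsto_rpow_neg_atTop (by norm_num : (0 : ℝ) < 1 / 4)).comp tendsto_natCast_atTop_atTop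
  have h2 : Tendsto (fun n : ℕ => (Real.sqrt n)⁻¹) atTop (𝓝 0) := hsq.inv_tendsto_atTop
  have h3 : Tendsto (fun n : ℕ => (5 : ℝ) / n) atTop (𝓝 0) := tendsto_const_div_atTop_nhds_zero_nat 5
  have := ((h1.const_mul sharpConstant).add (h2.const_mul 6)).add h3
  rw [mul_zero, mul_zero, add_zero, add_zero] at this
  refine this.congr' ?_
  filter_upwards [Filter.eventually_ge_atTop 1] with n hn
  have hn' : (0 : ℝ) < n := by exact_mod_cast hn
  have e1 : (n : ℝ) ^ (-(1 / 4 : ℝ)) = (n : ℝ) ^ (3 / 4 : ℝ) / n := by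
    rw [eq_div_iff hn'.ne', ← Real.rpow_add_one hn'.ne']
    norm_num
  have e2 : (Real.sqrt n)⁻¹ = Real.sqrt n / n := Real.sqrt_div_self.symm
  rw [e1, e2]
  ring

/-- **The maximal hexagon radius of EIP minimizers is asymptotically `√(n/3)`**: `r(M_n)/√n → 1/√3`
(from `#H_{r(M_n)} ≤ n` and the `N^{3/4}` law `n − #H_{r(M_n)} ≤ K_t n^{3/4} + 6√n + 5`).
[cite: DavoliPiovanoStefanelli2017, §4.1 Step 2 p. 654–655] -/
theorem tendsto_maxHexRadius_div_sqrt (M : ℕ → Finset Plane)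
    (hM : ∀ n, 1 ≤ n → IsTriMinimizer (M n) ∧ (M n).card = n) :
    Tendsto (fun n : ℕ => (maxHexRadius (M n) : ℝ) / Real.sqrt n) atTop (𝓝 (Real.sqrt 3)⁻¹) := by
  set r : ℕ → ℕ := fun n => maxHexRadius (M n) with hr
  -- basic facts for `n ≥ 1`
  have key : ∀ n : ℕ, 1 ≤ n →
      (3 * (r n : ℝ) ^ 2 + 3 * r n + 1 ≤ n) ∧
        ((n : ℝ) - (3 * (r n : ℝ) ^ 2 + 3 * r n + 1) ≤
          sharpConstant * (n : ℝ) ^ (3 / 4 : ℝ) + 6 * Real.sqrt n + 5) := by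
    intro n hn
    obtain ⟨hmin, hcard⟩ := hM n hn
    have hne : (M n).Nonempty := Finset.card_pos.1 (by rw [hcard]; exact hn)
    have h1 := card_hexagon_maxHexRadius_le hne hmin
    have h2 := card_sub_card_maxHexagon_le hne hmin
    rw [hcard] at h1 h2
    rw [Schmidt2013.card_hexagon] at h1 h2
    have e : ((3 * r n * (r n + 1) + 1 : ℕ) : ℝ) = 3 * (r n : ℝ) ^ 2 + 3 * r n + 1 := by
      push_cast; ring
    refine ⟨?_, ?_⟩
    · have : ((3 * r n * (r n + 1) + 1 : ℕ) : ℝ) ≤ n := by exact_mod_cast h1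
      rwa [e] at this
    · rwa [e] at h2
  -- `(3r² + 3r + 1)/n → 1`
  have hE := tendsto_errorTerm_div
  have hN : Tendsto (fun n : ℕ => (3 * (r n : ℝ) ^ 2 + 3 * r n + 1) / n) atTop (𝓝 1) := by
    have hlow : Tendsto (fun n : ℕ =>
        1 - (sharpConstant * (n : ℝ) ^ (3 / 4 : ℝ) + 6 * Real.sqrt n + 5) / n) atTop (𝓝 1) := by
      simpa using (tendsto_const_nhds (x := (1 : ℝ))).sub hE
    refine tendsto_of_tendsto_of_tendsto_of_le_of_le' hlow tendsto_const_nhds ?_ ?_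
    · filter_upwards [Filter.eventually_ge_atTop 1] with n hn
      have hn' : (0 : ℝ) < n := by exact_mod_cast hn
      have := (key n hn).2
      rw [sub_le_iff_le_add, ← add_div, le_div_iff₀ hn', one_mul]
      linarith
    · filter_upwards [Filter.eventually_ge_atTop 1] with n hn
      have hn' : (0 : ℝ) < n := by exact_mod_cast hn
      rw [div_le_one hn']
      exact (key n hn).1
  -- `(3r + 1)/n → 0` since `r ≤ √n`
  have hsq : Tendsto (fun n : ℕ => Real.sqrt n) atTop atTop :=
    Real.tendsto_sqrt_atTop.comp tendsto_natCast_atTop_atTop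
  have hsmall : Tendsto (fun n : ℕ => (3 * (r n : ℝ) + 1) / n) atTop (𝓝 0) := by
    have hup : Tendsto (fun n : ℕ => 3 * (Real.sqrt n)⁻¹ + 1 / (n : ℝ)) atTop (𝓝 0) := by
      simpa using (hsq.inv_tendsto_atTop.const_mul 3).add tendsto_one_div_atTop_nhds_zero_nat
    refine tendsto_of_tendsto_of_tendsto_of_le_of_le' tendsto_const_nhds hup ?_ ?_
    · filter_upwards [Filter.eventually_ge_atTop 1] with n hn
      positivity
    · filter_upwards [Filter.eventually_ge_atTop 1] with n hn
      have hn' : (0 : ℝ) < n := by exact_mod_cast hn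
      have hs : 0 < Real.sqrt n := Real.sqrt_pos.2 hn'
      have hrs : (r n : ℝ) ≤ Real.sqrt n := by
        rw [Real.le_sqrt (Nat.cast_nonneg _) hn'.le]
        nlinarith [(key n hn).1]
      rw [add_div, add_le_add_iff_right, mul_div_assoc]
      gcongr
      rw [div_le_iff₀ hn', ← Real.sqrt_div_self, div_mul_cancel₀ _ hn'.ne']
      exact hrs
  -- `r²/n → 1/3`
  have hsq2 : Tendsto (fun n : ℕ => (r n : ℝ) ^ 2 / n) atTop (𝓝 (1 / 3)) := by
    have := (hN.sub hsmall).div_const 3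
    rw [sub_zero] at this
    refine this.congr' ?_
    filter_upwards [Filter.eventually_ge_atTop 1] with n hn
    have hn' : (0 : ℝ) < n := by exact_mod_cast hn
    field_simp
    ring
  -- take square roots
  have := (Real.continuous_sqrt.tendsto _).comp hsq2
  rw [show Real.sqrt (1 / 3) = (Real.sqrt 3)⁻¹ by rw [Real.sqrt_div' _ (by norm_num), Real.sqrt_one, one_div]] at this
  refine this.congr' ?_
  filter_upwards [Filter.eventually_ge_atTop 1] with n hn
  show Real.sqrt ((r n : ℝ) ^ 2 / n) = (r n : ℝ) / Real.sqrt n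
  rw [Real.sqrt_div' _ (Nat.cast_nonneg _), Real.sqrt_sq (Nat.cast_nonneg _)]

/-- **Davoli–Piovano–Stefanelli 2017, Theorem 1.2, first clause (convergence to the Wulff shape,
weak*) PROVED**: for every sequence of EIP minimizers `M_n ⊂ 𝓛_t` (`#M_n = n`) there are
translations `a_n` (minus the centre of a maximal hexagon) such that the re-scaled empirical measures
`μ_{M_n + a_n} = n⁻¹ Σ_{x ∈ M_n} δ_{(x + a_n)/√n}` converge weak* to `(2/√3) χ_W`:
`∫ g dμ_{M_n + a_n} → (2/√3) ∫_W g` for every continuous `g` vanishing at infinity.  The same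
statement is Au Yeung–Friesecke–Schmidt 2012 Theorem 1.2 for the Heitmann–Radin sticky disc.
[cite: DavoliPiovanoStefanelli2017, Theorem 1.2 p. 632; §4.1 Step 2 p. 654–655]
[cite: AuYeungFrieseckeSchmidt2012, Theorem 1.2 (p0004); §5 (p0012)] -/
theorem weakStar_wulffHexagon (M : ℕ → Finset Plane)
    (hM : ∀ n, 1 ≤ n → IsTriMinimizer (M n) ∧ (M n).card = n)
    {g : Plane → ℝ} (hg : Continuous g) (h0 : Tendsto g (cocompact Plane) (𝓝 0)) :
    Tendsto (fun n => setEmpiricalIntegral ((M n).image fun x => x + -hexCenter (M n)) g) atTop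
      (𝓝 (2 / Real.sqrt 3 * ∫ y in wulffHexagon, g y)) := by
  classical
  -- centres of maximal hexagons
  set q : ℕ → Plane := fun n => hexCenter (M n) with hq_def
  have hq : ∀ n : ℕ, 1 ≤ n → hexConfig (maxHexRadius (M n)) (q n) ⊆ ↑(M n) := by
    intro n hn
    obtain ⟨hmin, hcard⟩ := hM n hn
    have hne : (M n).Nonempty := Finset.card_pos.1 (by rw [hcard]; exact hn)
    exact hexConfig_hexCenter_subset hne hmin
  obtain ⟨B, hB0, hB⟩ := exists_bound_of_tendsto_cocompact' hg h0
  set r : ℕ → ℕ := fun n => maxHexRadius (M n) with hr_def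
  have hr := tendsto_maxHexRadius_div_sqrt M hM
  have hmain := tendsto_hexagon_riemann_sum hr hg h0
  -- the hexagon part and the remainder
  set H : ℕ → Finset Plane := fun n => (hexagon (r n)).image fun v => triPoint v + q n with hH
  have hHsub : ∀ n, 1 ≤ n → H n ⊆ M n := fun n hn =>
    Finset.coe_subset.1 ((coe_image_hexagon (r n) (q n)).symm ▸ hq n hn)
  -- the remainder tends to zero
  have hrest : Tendsto (fun n : ℕ => (n : ℝ)⁻¹ *
      ∑ x ∈ M n \ H n, g ((Real.sqrt n)⁻¹ • (x + -q n))) atTop (𝓝 0) := by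
    have hE := tendsto_errorTerm_div
    rw [Metric.tendsto_atTop] at hE ⊢
    intro ε hε
    obtain ⟨N, hN⟩ := hE (ε / (B + 1)) (by positivity)
    refine ⟨max N 1, fun n hn => ?_⟩
    have hn1 : 1 ≤ n := le_of_max_le_right hn
    have hn' : (0 : ℝ) < n := by exact_mod_cast hn1
    have h := hN n (le_of_max_le_left hn)
    rw [dist_zero_right, Real.norm_eq_abs] at h ⊢
    obtain ⟨hmin, hcard⟩ := hM n hn1
    have hne : (M n).Nonempty := Finset.card_pos.1 (by rw [hcard]; exact hn1)
    -- `#(M ∖ H) ≤ K n^{3/4} + 6√n + 5`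
    have hcd : (((M n \ H n).card : ℕ) : ℝ) ≤
        sharpConstant * (n : ℝ) ^ (3 / 4 : ℝ) + 6 * Real.sqrt n + 5 := by
      have h1 := Finset.card_sdiff_add_card_eq_card (hHsub n hn1)
      have h2 := card_sub_card_maxHexagon_le hne hmin
      rw [hcard] at h1 h2
      have h3 : (H n).card = (hexagon (r n)).card := card_image_hexagon _ _
      have : (((M n \ H n).card : ℕ) : ℝ) = n - (hexagon (r n)).card := by
        rw [← h3]
        have : (((M n \ H n).card : ℕ) : ℝ) + (H n).card = n := by exact_mod_cast h1
        linarith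
      rw [this]
      exact h2
    have habs : |∑ x ∈ M n \ H n, g ((Real.sqrt n)⁻¹ • (x + -q n))| ≤
        B * (sharpConstant * (n : ℝ) ^ (3 / 4 : ℝ) + 6 * Real.sqrt n + 5) := by
      calc |∑ x ∈ M n \ H n, g ((Real.sqrt n)⁻¹ • (x + -q n))|
          ≤ ∑ x ∈ M n \ H n, |g ((Real.sqrt n)⁻¹ • (x + -q n))| := Finset.abs_sum_le_sum_abs _ _
        _ ≤ ∑ x ∈ M n \ H n, B := Finset.sum_le_sum fun x _ => hB _
        _ = (M n \ H n).card * B := by rw [Finset.sum_const, nsmul_eq_mul]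
        _ ≤ (sharpConstant * (n : ℝ) ^ (3 / 4 : ℝ) + 6 * Real.sqrt n + 5) * B := by gcongr
        _ = _ := mul_comm _ _
    have hpos : 0 ≤ (sharpConstant * (n : ℝ) ^ (3 / 4 : ℝ) + 6 * Real.sqrt n + 5) / n := by
      have : 0 ≤ sharpConstant := by unfold sharpConstant; positivity
      positivity
    rw [abs_of_nonneg hpos] at h
    rw [abs_mul, abs_of_pos (inv_pos.2 hn'), inv_mul_eq_div, div_lt_iff₀ hn']
    rw [div_lt_iff₀ hn', div_mul_eq_mul_div, lt_div_iff₀ (by positivity)] at h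
    nlinarith
  -- assembling
  have hsum := hmain.add hrest
  rw [add_zero] at hsum
  refine hsum.congr' ?_
  filter_upwards [Filter.eventually_ge_atTop 1] with n hn
  have hcard : ((M n).image fun x => x + -q n).card = n := by
    rw [Finset.card_image_of_injective _ (add_left_injective _), (hM n hn).2]
  unfold setEmpiricalIntegral
  rw [hcard, Finset.sum_image fun x _ y _ h => add_left_injective _ h, ← mul_add,
    ← Finset.sum_sdiff (hHsub n hn), add_comm]
  congr 2
  rw [hH, Finset.sum_image fun v _ w _ h => triPoint_injective (add_right_cancel h)]
  refine Finset.sum_congr rfl fun v _ => ?_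
  simp only [hq_def, add_neg_cancel_right]

/-! ## §2 Theorem 1.2, third clause: the flat-norm rate `‖μ_{M_n+a_n} − (2/√3)χ_W‖_F ≤ (2K_t + δ) n^{−1/4}` -/

open AuYeungFrieseckeSchmidt2012 (cell latA latB mem_cell_iff mem_cell_floor disjoint_cell
  measurableSet_cell norm_sub_le_of_mem_cell volume_cell floor_mem_hexagon not_mem_cell_of_mem_hexagon
  riemann_cell_estimate mem_wulffHexagon_iff measurableSet_wulffHexagon isCompact_wulffHexagon)
open Literature.Geometry.DiscreteGeometry.HarborthSpiral (mem_hexagon Inside hexagon_mono)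
open Schmidt2013 (flatNorm)

/-- `|∫_U φ − ∫_W φ| ≤ |U ∖ W| + |W ∖ U|` for `|φ| ≤ 1` (the step "`(2/√3)|∫_{H} φ − ∫_W φ| ≤ (2/√3)|H △ W|`"
of the flat-norm estimate). [cite: DavoliPiovanoStefanelli2017, §4.1 Step 3 (79)–(80) p. 655] -/
theorem abs_setIntegral_sub_setIntegral_le {φ : Plane → ℝ} (hφm : AEStronglyMeasurable φ volume)
    (hφ : ∀ y, |φ y| ≤ 1) {U W : Set Plane} (hU : MeasurableSet U) (hW : MeasurableSet W)
    (hUf : volume U ≠ ⊤) (hWf : volume W ≠ ⊤) :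
    |(∫ y in U, φ y) - ∫ y in W, φ y| ≤ volume.real (U \ W) + volume.real (W \ U) := by
  have iU : IntegrableOn φ U volume := Measure.integrableOn_of_bounded (M := 1) hUf hφm
    (Eventually.of_forall fun y => by rw [Real.norm_eq_abs]; exact hφ y)
  have iW : IntegrableOn φ W volume := Measure.integrableOn_of_bounded (M := 1) hWf hφm
    (Eventually.of_forall fun y => by rw [Real.norm_eq_abs]; exact hφ y)
  rw [← integral_inter_add_sdiff hW iU, ← integral_inter_add_sdiff hU iW, Set.inter_comm W U]
  have h1 := norm_setIntegral_le_of_norm_le_const ((measure_mono sdiff_le).trans_lt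
    hUf.lt_top) (f := φ) (C := 1) (s := U \ W) (μ := volume) (fun y _ => by rw [Real.norm_eq_abs]; exact hφ y)
  have h2 := norm_setIntegral_le_of_norm_le_const ((measure_mono sdiff_le).trans_lt
    hWf.lt_top) (f := φ) (C := 1) (s := W \ U) (μ := volume) (fun y _ => by rw [Real.norm_eq_abs]; exact hφ y)
  rw [Real.norm_eq_abs, one_mul] at h1 h2
  calc |(∫ y in U ∩ W, φ y) + (∫ y in U \ W, φ y) - ((∫ y in U ∩ W, φ y) + ∫ y in W \ U, φ y)|
      = |(∫ y in U \ W, φ y) + -(∫ y in W \ U, φ y)| := by ring_nf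
    _ ≤ |∫ y in U \ W, φ y| + |-(∫ y in W \ U, φ y)| := abs_add_le _ _
    _ ≤ volume.real (U \ W) + volume.real (W \ U) := by rw [abs_neg]; exact add_le_add h1 h2

/-- The volume of a finite union of cells. [cite: AuYeungFrieseckeSchmidt2012, §5 (p0012)] -/
theorem volume_biUnion_cell_le {s : ℝ} (hs : 0 < s) (F : Finset (ℤ × ℤ)) :
    volume (⋃ v ∈ F, cell s v) ≤ ENNReal.ofReal (F.card * (Real.sqrt 3 / 2 / s ^ 2)) := by
  refine (measure_biUnion_finset_le F _).trans ?_
  simp_rw [volume_cell hs]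
  rw [Finset.sum_const, ← ENNReal.ofReal_nsmul, nsmul_eq_mul]

/-- **Outer shell**: `W ∖ U ⊆ ⋃_{v ∈ H_R ∖ H_r} Z_s(v)` with `R = ⌊s/√3⌋ + 3`, where
`U = ⋃_{v ∈ H_r} Z_s(v)`. [cite: DavoliPiovanoStefanelli2017, §4.1 Step 2 p. 654–655] -/
theorem wulffHexagon_diff_subset {s : ℝ} (hs : 0 < s) (r : ℕ) :
    wulffHexagon \ (⋃ v ∈ hexagon r, cell s v) ⊆
      ⋃ v ∈ hexagon (⌊s / Real.sqrt 3⌋₊ + 3) \ hexagon r, cell s v := by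
  intro y hy
  obtain ⟨hyW, hyU⟩ := hy
  rw [mem_wulffHexagon_iff] at hyW
  obtain ⟨ha, hb, hab⟩ := hyW
  simp only [Set.mem_iUnion, not_exists] at hyU ⊢
  set v : ℤ × ℤ := (⌊s * latA y⌋, ⌊s * latB y⌋) with hv
  have hyv : y ∈ cell s v := mem_cell_floor s y
  have h3 : 0 < Real.sqrt 3 := by positivity
  have hR : s / Real.sqrt 3 + 2 < ((⌊s / Real.sqrt 3⌋₊ + 3 : ℕ) : ℝ) := by
    push_cast
    linarith [Nat.lt_floor_add_one (s / Real.sqrt 3)]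
  have hRs : (Real.sqrt 3)⁻¹ + 2 / s < ((⌊s / Real.sqrt 3⌋₊ + 3 : ℕ) : ℝ) / s := by
    rw [lt_div_iff₀ hs, add_mul, div_mul_cancel₀ _ hs.ne', inv_mul_eq_div]
    exact hR
  refine ⟨v, Finset.mem_sdiff.2 ⟨?_, fun hvr => hyU v hvr hyv⟩, hyv⟩
  exact floor_mem_hexagon hs (by linarith) (by linarith) (by linarith)

/-- **Inner shell**: `U ∖ W ⊆ ⋃_{v ∈ H_r ∖ H_{r−3}} Z_s(v)` when `r/s ≤ 1/√3` and `2/s < 1/√3`.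
[cite: DavoliPiovanoStefanelli2017, §4.1 Step 2 p. 654–655] -/
theorem biUnion_diff_wulffHexagon_subset {s : ℝ} (hs : 0 < s) {r : ℕ}
    (hrs : (r : ℝ) / s ≤ (Real.sqrt 3)⁻¹) (hs2 : 2 / s < (Real.sqrt 3)⁻¹) :
    (⋃ v ∈ hexagon r, cell s v) \ wulffHexagon ⊆ ⋃ v ∈ hexagon r \ hexagon (r - 3), cell s v := by
  intro y hy
  obtain ⟨hyU, hyW⟩ := hy
  simp only [Set.mem_iUnion] at hyU ⊢
  obtain ⟨v, hv, hyv⟩ := hyU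
  refine ⟨v, Finset.mem_sdiff.2 ⟨hv, fun hv' => ?_⟩, hyv⟩
  rw [mem_wulffHexagon_iff] at hyW
  have key : ((r - 3 : ℕ) : ℝ) / s + 2 / s < (Real.sqrt 3)⁻¹ := by
    rcases le_or_gt 3 r with h3 | h3
    · rw [Nat.cast_sub h3, ← add_div]
      push_cast
      calc ((r : ℝ) - 3 + 2) / s < r / s := by rw [div_lt_div_iff_of_pos_right hs]; linarith
        _ ≤ (Real.sqrt 3)⁻¹ := hrs
    · rw [Nat.sub_eq_zero_of_le h3.le, Nat.cast_zero, zero_div, zero_add]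
      exact hs2
  have hor : ((r - 3 : ℕ) : ℝ) / s + 2 / s < |latA y| ∨ ((r - 3 : ℕ) : ℝ) / s + 2 / s < |latB y| ∨
      ((r - 3 : ℕ) : ℝ) / s + 2 / s < |latA y + latB y| := by
    by_cases h1 : |latA y| ≤ (Real.sqrt 3)⁻¹
    · by_cases h2 : |latB y| ≤ (Real.sqrt 3)⁻¹
      · have h3 : ¬ |latA y + latB y| ≤ (Real.sqrt 3)⁻¹ := fun h => hyW ⟨h1, h2, h⟩
        exact Or.inr (Or.inr (key.trans (not_le.1 h3)))
      · exact Or.inr (Or.inl (key.trans (not_le.1 h2)))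
    · exact Or.inl (key.trans (not_le.1 h1))
  exact not_mem_cell_of_mem_hexagon hs hor hv' hyv

/-- **Counting the outer shell**: `#(H_R ∖ H_r) ≤ (n − #H_r) + 7√3 √n + 37` for `R = ⌊√n/√3⌋ + 3`,
`r ≤ √n/√3`. [cite: DavoliPiovanoStefanelli2017, §4.1 Step 2 p. 654–655] -/
theorem card_outer_shell_le {n : ℕ} (hn : 0 < n) {r : ℕ} (hrs : (r : ℝ) / Real.sqrt n ≤ (Real.sqrt 3)⁻¹) :
    ((hexagon (⌊Real.sqrt n / Real.sqrt 3⌋₊ + 3) \ hexagon r).card : ℝ) ≤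
      ((n : ℝ) - (hexagon r).card) + 7 * Real.sqrt 3 * Real.sqrt n + 37 := by
  have hn' : (0 : ℝ) < n := by exact_mod_cast hn
  have hs : 0 < Real.sqrt n := Real.sqrt_pos.2 hn'
  have h3 : 0 < Real.sqrt 3 := by positivity
  have h33 : Real.sqrt 3 * Real.sqrt 3 = 3 := Real.mul_self_sqrt (by norm_num)
  have hss : Real.sqrt n * Real.sqrt n = n := Real.mul_self_sqrt hn'.le
  set R := ⌊Real.sqrt n / Real.sqrt 3⌋₊ + 3 with hR
  have hR1 : (R : ℝ) ≤ Real.sqrt n / Real.sqrt 3 + 3 := by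
    rw [hR]; push_cast; linarith [Nat.floor_le (show 0 ≤ Real.sqrt n / Real.sqrt 3 by positivity)]
  have hrR : r ≤ R := by
    have h1 : (r : ℝ) ≤ Real.sqrt n / Real.sqrt 3 := by
      rwa [div_le_iff₀ hs, ← div_eq_inv_mul] at hrs
    have h2 : (r : ℝ) < R := by
      rw [hR]; push_cast; linarith [Nat.lt_floor_add_one (Real.sqrt n / Real.sqrt 3)]
    exact_mod_cast h2.le
  rw [Finset.card_sdiff_of_subset (hexagon_mono hrR), Nat.cast_sub (Finset.card_le_card (hexagon_mono hrR)),
    Schmidt2013.card_hexagon R]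
  push_cast
  set x := Real.sqrt n / Real.sqrt 3 with hxdef
  have hx : 0 ≤ x := by positivity
  have e : x * x = n / 3 := by
    rw [hxdef, div_mul_div_comm, hss, h33]
  have e3 : 7 * Real.sqrt 3 * Real.sqrt n = 21 * x := by
    calc 7 * Real.sqrt 3 * Real.sqrt n = 7 * Real.sqrt 3 * (x * Real.sqrt 3) := by
          rw [hxdef, div_mul_cancel₀ _ h3.ne']
      _ = 7 * (Real.sqrt 3 * Real.sqrt 3) * x := by ring
      _ = 21 * x := by rw [h33]; ring
  have hR0 : (0 : ℝ) ≤ R := Nat.cast_nonneg _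
  have hRR : (R : ℝ) * (R + 1) ≤ (x + 3) * (x + 4) :=
    mul_le_mul hR1 (by linarith) (by positivity) (by positivity)
  nlinarith [hRR, e, e3]

/-- **Counting the inner shell**: `#(H_r ∖ H_{r−3}) ≤ 18 r + 19`. [cite: DavoliPiovanoStefanelli2017, §4.1 Step 2 p. 654–655] -/
theorem card_inner_shell_le (r : ℕ) : (hexagon r \ hexagon (r - 3)).card ≤ 18 * r + 19 := by
  rw [Finset.card_sdiff_of_subset (hexagon_mono (Nat.sub_le r 3)), Schmidt2013.card_hexagon,
    Schmidt2013.card_hexagon]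
  rcases le_or_gt 3 r with h3 | h3
  · obtain ⟨t, rfl⟩ := Nat.exists_eq_add_of_le h3
    rw [show 3 + t - 3 = t by omega]
    have e : 3 * (3 + t) * (3 + t + 1) + 1 = (3 * t * (t + 1) + 1) + (18 * t + 36) := by ring
    rw [e, Nat.add_sub_cancel_left]
    omega
  · interval_cases r <;> simp

/-- **The empirical integral of a translated minimizer, split along the maximal hexagon.**
[cite: DavoliPiovanoStefanelli2017, §4.1 Step 2 p. 654–655] -/
theorem setEmpiricalIntegral_split {M : Finset Plane} {n : ℕ} (hn : 1 ≤ n)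
    (hmin : IsTriMinimizer M) (hcard : M.card = n) (φ : Plane → ℝ) :
    setEmpiricalIntegral (M.image fun x => x + -hexCenter M) φ =
      (n : ℝ)⁻¹ * (∑ v ∈ hexagon (maxHexRadius M), φ ((Real.sqrt n)⁻¹ • triPoint v) +
        ∑ x ∈ M \ (hexagon (maxHexRadius M)).image (fun v => triPoint v + hexCenter M),
          φ ((Real.sqrt n)⁻¹ • (x + -hexCenter M))) := by
  classical
  have hne : M.Nonempty := Finset.card_pos.1 (by rw [hcard]; exact hn)
  have hHsub : (hexagon (maxHexRadius M)).image (fun v => triPoint v + hexCenter M) ⊆ M :=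
    Finset.coe_subset.1 ((coe_image_hexagon _ _).symm ▸ hexConfig_hexCenter_subset hne hmin)
  have hc : (M.image fun x => x + -hexCenter M).card = n := by
    rw [Finset.card_image_of_injective _ (add_left_injective _), hcard]
  unfold setEmpiricalIntegral
  rw [hc, Finset.sum_image fun x _ y _ h => add_left_injective _ h, ← Finset.sum_sdiff hHsub, add_comm,
    Finset.sum_image fun v _ w _ h => triPoint_injective (add_right_cancel h)]
  congr 2
  refine Finset.sum_congr rfl fun v _ => ?_
  simp only [add_neg_cancel_right]

/-- **The flat-norm estimate for one test function** (`φ` 1-Lipschitz, `|φ| ≤ 1`, `n ≥ 13`):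
`|∫ φ dμ_{M_n + a_n} − (2/√3)∫_W φ| ≤ (2E_n + (7√3 + 18)√n + 56)/n + 2/√n`, `E_n = K_t n^{3/4} + 6√n + 5`.
[cite: DavoliPiovanoStefanelli2017, (18) p. 632; §4.1 Step 3 (79)–(80) p. 655] -/
theorem flat_estimate {M : Finset Plane} {n : ℕ} (hn : 13 ≤ n) (hmin : IsTriMinimizer M)
    (hcard : M.card = n) {φ : Plane → ℝ} (hL : LipschitzWith 1 φ) (hφ : ∀ y, |φ y| ≤ 1) :
    |setEmpiricalIntegral (M.image fun x => x + -hexCenter M) φ -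
        2 / Real.sqrt 3 * ∫ y in wulffHexagon, φ y| ≤
      (2 * (sharpConstant * (n : ℝ) ^ (3 / 4 : ℝ) + 6 * Real.sqrt n + 5) +
          (7 * Real.sqrt 3 + 18) * Real.sqrt n + 56) / n + 2 / Real.sqrt n := by
  classical
  have hn1 : 1 ≤ n := by omega
  have hn' : (0 : ℝ) < n := by exact_mod_cast (show 0 < n by omega)
  have hs : 0 < Real.sqrt n := Real.sqrt_pos.2 hn'
  have hs2 : Real.sqrt n ^ 2 = n := Real.sq_sqrt hn'.le
  have h3 : 0 < Real.sqrt 3 := by positivity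
  have hne : M.Nonempty := Finset.card_pos.1 (by rw [hcard]; exact hn1)
  have hφm : AEStronglyMeasurable φ volume := hL.continuous.aestronglyMeasurable
  set r := maxHexRadius M with hr
  set q := hexCenter M with hq
  set s := Real.sqrt n with hsdef
  set E := sharpConstant * (n : ℝ) ^ (3 / 4 : ℝ) + 6 * s + 5 with hEdef
  set H := (hexagon r).image (fun v => triPoint v + q) with hH
  have hHsub : H ⊆ M := Finset.coe_subset.1 ((coe_image_hexagon _ _).symm ▸ hexConfig_hexCenter_subset hne hmin)
  have hHcard : H.card = (hexagon r).card := card_image_hexagon _ _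
  have hE : (n : ℝ) - (hexagon r).card ≤ E := by
    have := card_sub_card_maxHexagon_le hne hmin; rwa [hcard] at this
  have hNle : ((hexagon r).card : ℝ) ≤ n := by
    have := card_hexagon_maxHexRadius_le hne hmin; rw [hcard] at this; exact_mod_cast this
  have hNle' : 3 * (r : ℝ) * (r + 1) + 1 ≤ n := by
    rw [Schmidt2013.card_hexagon] at hNle
    exact_mod_cast hNle
  have hr3 : (r : ℝ) * Real.sqrt 3 ≤ s := by
    rw [hsdef, Real.le_sqrt (by positivity) hn'.le, mul_pow, Real.sq_sqrt (by norm_num)]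
    nlinarith
  have hrs : (r : ℝ) / s ≤ (Real.sqrt 3)⁻¹ := by
    rw [div_le_iff₀ hs, ← div_eq_inv_mul, le_div_iff₀ h3]
    exact hr3
  have h3one : 1 ≤ Real.sqrt 3 := by
    rw [← Real.sqrt_one]; exact Real.sqrt_le_sqrt (by norm_num)
  have hrn : (r : ℝ) ≤ s :=
    (le_mul_of_one_le_right (Nat.cast_nonneg _) h3one).trans hr3
  have hs13 : 2 / s < (Real.sqrt 3)⁻¹ := by
    rw [div_lt_iff₀ hs, ← div_eq_inv_mul, lt_div_iff₀ h3, hsdef, Real.lt_sqrt (by positivity),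
      mul_pow, Real.sq_sqrt (by norm_num)]
    have h12 : (12 : ℝ) < n := by exact_mod_cast (show 12 < n by omega)
    linarith
  -- the union of cells
  set U : Set Plane := ⋃ v ∈ hexagon r, cell s v with hU
  have hUm : MeasurableSet U := Finset.measurableSet_biUnion _ fun v _ => measurableSet_cell _ v
  have hUf : volume U ≠ ⊤ := ((volume_biUnion_cell_le hs (hexagon r)).trans_lt ENNReal.ofReal_lt_top).ne
  have hWf : volume wulffHexagon ≠ ⊤ := isCompact_wulffHexagon.measure_lt_top.ne
  -- (ii) the remainder
  have hrest : |∑ x ∈ M \ H, φ (s⁻¹ • (x + -q))| ≤ E := by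
    calc |∑ x ∈ M \ H, φ (s⁻¹ • (x + -q))| ≤ ∑ x ∈ M \ H, |φ (s⁻¹ • (x + -q))| :=
          Finset.abs_sum_le_sum_abs _ _
      _ ≤ ∑ x ∈ M \ H, (1 : ℝ) := Finset.sum_le_sum fun x _ => hφ _
      _ = ((M \ H).card : ℝ) := by rw [Finset.sum_const, nsmul_eq_mul, mul_one]
      _ = n - (hexagon r).card := by
          have h1 := Finset.card_sdiff_add_card_eq_card hHsub
          rw [hcard, hHcard] at h1
          have : (((M \ H).card : ℕ) : ℝ) + (hexagon r).card = n := by exact_mod_cast h1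
          linarith
      _ ≤ E := hE
  -- (iii) the Riemann sum on the hexagon
  have hsplitU : ∫ y in U, φ y = ∑ v ∈ hexagon r, ∫ y in cell s v, φ y := by
    simp only [hU]
    refine integral_biUnion_finset _ (fun v _ => measurableSet_cell _ v) ?_ ?_
    · intro v _ w _ hvw; exact disjoint_cell hvw
    · intro v _
      exact Measure.integrableOn_of_bounded (M := 1)
        (by rw [volume_cell hs]; exact ENNReal.ofReal_ne_top) hφm
        (Eventually.of_forall fun y => by rw [Real.norm_eq_abs]; exact hφ y)
  have hR : |(n : ℝ)⁻¹ * ∑ v ∈ hexagon r, φ (s⁻¹ • triPoint v) - 2 / Real.sqrt 3 * ∫ y in U, φ y| ≤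
      2 / s := by
    have hcell : ∀ v ∈ hexagon r,
        |(n : ℝ)⁻¹ * φ (s⁻¹ • triPoint v) - 2 / Real.sqrt 3 * ∫ y in cell s v, φ y| ≤ 2 / s / n := by
      intro v _
      have hε' : ∀ y ∈ cell s v, |φ (s⁻¹ • triPoint v) - φ y| ≤ 2 / s := by
        intro y hy
        have := hL.dist_le_mul (s⁻¹ • triPoint v) y
        rw [NNReal.coe_one, one_mul, Real.dist_eq, dist_comm, dist_eq_norm] at this
        exact this.trans (norm_sub_le_of_mem_cell hs hy)
      have h := riemann_cell_estimate hφm hφ hs v hε'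
      rw [hs2] at h
      have e : (n : ℝ)⁻¹ * φ (s⁻¹ • triPoint v) - 2 / Real.sqrt 3 * ∫ y in cell s v, φ y =
          2 / Real.sqrt 3 * (Real.sqrt 3 / 2 / n * φ (s⁻¹ • triPoint v) - ∫ y in cell s v, φ y) := by
        field_simp
      rw [e, abs_mul, abs_of_pos (by positivity)]
      calc 2 / Real.sqrt 3 * |Real.sqrt 3 / 2 / n * φ (s⁻¹ • triPoint v) - ∫ y in cell s v, φ y|
          ≤ 2 / Real.sqrt 3 * (2 / s * (Real.sqrt 3 / 2 / n)) := by gcongr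
        _ = 2 / s / n := by field_simp
    rw [hsplitU, Finset.mul_sum, Finset.mul_sum, ← Finset.sum_sub_distrib]
    calc |∑ v ∈ hexagon r, ((n : ℝ)⁻¹ * φ (s⁻¹ • triPoint v) - 2 / Real.sqrt 3 * ∫ y in cell s v, φ y)|
        ≤ ∑ v ∈ hexagon r, |(n : ℝ)⁻¹ * φ (s⁻¹ • triPoint v) - 2 / Real.sqrt 3 * ∫ y in cell s v, φ y| :=
          Finset.abs_sum_le_sum_abs _ _
      _ ≤ ∑ v ∈ hexagon r, 2 / s / n := Finset.sum_le_sum hcell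
      _ = (hexagon r).card * (2 / s / n) := by rw [Finset.sum_const, nsmul_eq_mul]
      _ ≤ n * (2 / s / n) := by gcongr
      _ = 2 / s := by field_simp
  -- (iv) the two shells
  have hUW : |(∫ y in U, φ y) - ∫ y in wulffHexagon, φ y| ≤
      (E + 7 * Real.sqrt 3 * s + 37 + (18 * r + 19)) * (Real.sqrt 3 / 2 / n) := by
    have h := abs_setIntegral_sub_setIntegral_le hφm hφ hUm measurableSet_wulffHexagon hUf hWf
    have h1 : volume.real (U \ wulffHexagon) ≤ (18 * (r : ℝ) + 19) * (Real.sqrt 3 / 2 / n) := by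
      rw [measureReal_def]
      refine ENNReal.toReal_le_of_le_ofReal (by positivity) ?_
      refine (measure_mono (biUnion_diff_wulffHexagon_subset hs hrs hs13)).trans ?_
      refine (volume_biUnion_cell_le hs _).trans ?_
      rw [hs2]
      gcongr
      exact_mod_cast card_inner_shell_le r
    have h2 : volume.real (wulffHexagon \ U) ≤ (E + 7 * Real.sqrt 3 * s + 37) * (Real.sqrt 3 / 2 / n) := by
      rw [measureReal_def]
      have hpos : 0 ≤ E + 7 * Real.sqrt 3 * s + 37 := by
        have : 0 ≤ sharpConstant := by unfold sharpConstant; positivity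
        positivity
      refine ENNReal.toReal_le_of_le_ofReal (by positivity) ?_
      refine (measure_mono (wulffHexagon_diff_subset hs r)).trans ?_
      refine (volume_biUnion_cell_le hs _).trans ?_
      rw [hs2]
      gcongr
      exact (card_outer_shell_le (show 0 < n by omega) hrs).trans (by linarith)
    calc |(∫ y in U, φ y) - ∫ y in wulffHexagon, φ y|
        ≤ volume.real (U \ wulffHexagon) + volume.real (wulffHexagon \ U) := h
      _ ≤ (18 * (r : ℝ) + 19) * (Real.sqrt 3 / 2 / n) +
          (E + 7 * Real.sqrt 3 * s + 37) * (Real.sqrt 3 / 2 / n) := add_le_add h1 h2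
      _ = _ := by ring
  -- assembling
  rw [setEmpiricalIntegral_split hn1 hmin hcard φ]
  have etot : (n : ℝ)⁻¹ * (∑ v ∈ hexagon r, φ (s⁻¹ • triPoint v) + ∑ x ∈ M \ H, φ (s⁻¹ • (x + -q))) -
      2 / Real.sqrt 3 * ∫ y in wulffHexagon, φ y =
      ((n : ℝ)⁻¹ * ∑ v ∈ hexagon r, φ (s⁻¹ • triPoint v) - 2 / Real.sqrt 3 * ∫ y in U, φ y) +
        (n : ℝ)⁻¹ * ∑ x ∈ M \ H, φ (s⁻¹ • (x + -q)) +
        2 / Real.sqrt 3 * ((∫ y in U, φ y) - ∫ y in wulffHexagon, φ y) := by ring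
  rw [etot]
  have hK0 : 0 ≤ sharpConstant := by unfold sharpConstant; positivity
  calc |((n : ℝ)⁻¹ * ∑ v ∈ hexagon r, φ (s⁻¹ • triPoint v) - 2 / Real.sqrt 3 * ∫ y in U, φ y) +
        (n : ℝ)⁻¹ * ∑ x ∈ M \ H, φ (s⁻¹ • (x + -q)) +
        2 / Real.sqrt 3 * ((∫ y in U, φ y) - ∫ y in wulffHexagon, φ y)|
      ≤ |(n : ℝ)⁻¹ * ∑ v ∈ hexagon r, φ (s⁻¹ • triPoint v) - 2 / Real.sqrt 3 * ∫ y in U, φ y| +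
        |(n : ℝ)⁻¹ * ∑ x ∈ M \ H, φ (s⁻¹ • (x + -q))| +
        |2 / Real.sqrt 3 * ((∫ y in U, φ y) - ∫ y in wulffHexagon, φ y)| :=
        (abs_add_le _ _).trans (add_le_add (abs_add_le _ _) le_rfl)
    _ ≤ 2 / s + (n : ℝ)⁻¹ * E +
        2 / Real.sqrt 3 * ((E + 7 * Real.sqrt 3 * s + 37 + (18 * r + 19)) * (Real.sqrt 3 / 2 / n)) := by
        refine add_le_add (add_le_add hR ?_) ?_
        · rw [abs_mul, abs_of_pos (inv_pos.2 hn')]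
          exact mul_le_mul_of_nonneg_left hrest (inv_pos.2 hn').le
        · rw [abs_mul, abs_of_pos (by positivity)]
          exact mul_le_mul_of_nonneg_left hUW (by positivity)
    _ = (2 * E + 7 * Real.sqrt 3 * s + 56 + 18 * r) / n + 2 / s := by field_simp; ring
    _ ≤ (2 * E + (7 * Real.sqrt 3 + 18) * s + 56) / n + 2 / s := by
        have hnum : 2 * E + 7 * Real.sqrt 3 * s + 56 + 18 * r ≤
            2 * E + (7 * Real.sqrt 3 + 18) * s + 56 := by linarith
        have := div_le_div_of_nonneg_right hnum hn'.le
        linarith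

/-- The test-function set of the flat norm is non-empty (`φ = 0`). [cite: Schmidt2013, §2 (flat norm)] -/
private theorem flatNorm_le_of_forall {L : (Plane → ℝ) → ℝ} {B : ℝ}
    (h : ∀ φ : Plane → ℝ, LipschitzWith 1 φ → (∀ y, |φ y| ≤ 1) → L φ ≤ B) : flatNorm L ≤ B := by
  unfold flatNorm
  refine csSup_le ⟨L (fun _ => 0), ⟨fun _ => 0, (LipschitzWith.const (0 : ℝ)).weaken (by norm_num),
    fun _ => by simp, rfl⟩⟩ ?_
  rintro t ⟨φ, hL, hb, rfl⟩
  exact h φ hL hb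

/-- **Davoli–Piovano–Stefanelli 2017, Theorem 1.2 (18): the flat-norm rate**, explicit form: for a
minimizer `M_n` with `n ≥ 13`, `‖μ_{M_n + a_n} − (2/√3)χ_W‖_F ≤ (2E_n + (7√3+18)√n + 56)/n + 2/√n`.
[cite: DavoliPiovanoStefanelli2017, Theorem 1.2 (18) p. 632; §4.1 Step 3 p. 655] -/
theorem flatNorm_le {M : Finset Plane} {n : ℕ} (hn : 13 ≤ n) (hmin : IsTriMinimizer M)
    (hcard : M.card = n) :
    flatNorm (fun φ => setEmpiricalIntegral (M.image fun x => x + -hexCenter M) φ -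
        2 / Real.sqrt 3 * ∫ y in wulffHexagon, φ y) ≤
      (2 * (sharpConstant * (n : ℝ) ^ (3 / 4 : ℝ) + 6 * Real.sqrt n + 5) +
          (7 * Real.sqrt 3 + 18) * Real.sqrt n + 56) / n + 2 / Real.sqrt n :=
  flatNorm_le_of_forall fun _ hL hφ => (le_abs_self _).trans (flat_estimate hn hmin hcard hL hφ)

/-- **Theorem 1.2 (18) in the `δ`-form of the named fact**: for every `δ > 0`, eventually
`‖μ_{M_n + a_n} − (2/√3)χ_W‖_F ≤ (2K_t + δ) n^{−1/4}`. [cite: DavoliPiovanoStefanelli2017, Theorem 1.2 (18)–(19) p. 632] -/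
theorem eventually_flatNorm_le (M : ℕ → Finset Plane)
    (hM : ∀ n, 1 ≤ n → IsTriMinimizer (M n) ∧ (M n).card = n) {δ : ℝ} (hδ : 0 < δ) :
    ∀ᶠ n : ℕ in atTop,
      flatNorm (fun φ => setEmpiricalIntegral ((M n).image fun x => x + -hexCenter (M n)) φ -
          2 / Real.sqrt 3 * ∫ y in wulffHexagon, φ y) ≤
        (2 * sharpConstant + δ) * (n : ℝ) ^ (-(1 / 4 : ℝ)) := by
  -- the lower-order terms are `≤ 113/√n = 113 n^{-1/4} n^{-1/4} ≤ δ n^{-1/4}` eventually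
  have h1 : Tendsto (fun n : ℕ => (n : ℝ) ^ (-(1 / 4 : ℝ))) atTop (𝓝 0) :=
    (tendsto_rpow_neg_atTop (by norm_num : (0 : ℝ) < 1 / 4)).comp tendsto_natCast_atTop_atTop
  have hev : ∀ᶠ n : ℕ in atTop, 113 * (n : ℝ) ^ (-(1 / 4 : ℝ)) < δ := by
    have := (h1.const_mul 113)
    rw [mul_zero] at this
    exact this.eventually_lt_const hδ
  filter_upwards [Filter.eventually_ge_atTop 13, hev] with n hn hsmall
  obtain ⟨hmin, hcard⟩ := hM n (by omega)
  refine (flatNorm_le hn hmin hcard).trans ?_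
  have hn' : (0 : ℝ) < n := by exact_mod_cast (show 0 < n by omega)
  have hs : 0 < Real.sqrt n := Real.sqrt_pos.2 hn'
  have hs1 : 1 ≤ Real.sqrt n := by
    rw [← Real.sqrt_one]; exact Real.sqrt_le_sqrt (by exact_mod_cast (show 1 ≤ n by omega))
  have hK0 : 0 ≤ sharpConstant := by unfold sharpConstant; positivity
  have hn0 : (n : ℝ) ≠ 0 := hn'.ne'
  have hs0 : Real.sqrt n ≠ 0 := hs.ne'
  set t : ℝ := (n : ℝ) ^ (-(1 / 4 : ℝ)) with ht
  have ht0 : 0 < t := Real.rpow_pos_of_pos hn' _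
  -- `n^{3/4}/n = t`, `1/√n = √n/n = t²`, `1/n ≤ t²`
  have e1 : (n : ℝ) ^ (3 / 4 : ℝ) / n = t := by
    rw [div_eq_iff hn0, ht, ← Real.rpow_add_one hn0]; norm_num
  have e2 : (Real.sqrt n)⁻¹ = t ^ 2 := by
    rw [ht, ← Real.rpow_natCast, ← Real.rpow_mul hn'.le, Real.sqrt_eq_rpow, ← Real.rpow_neg hn'.le]
    norm_num
  have hsn : Real.sqrt n / n = t ^ 2 := by rw [Real.sqrt_div_self, e2]
  have hs_le_n : Real.sqrt n ≤ n := by nlinarith [Real.sq_sqrt hn'.le]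
  have h1n : (1 : ℝ) / n ≤ t ^ 2 := by
    rw [← e2, one_div]; exact inv_anti₀ hs hs_le_n
  have h73 : 7 * Real.sqrt 3 ≤ 15 := by
    nlinarith [Real.sq_sqrt (show (0 : ℝ) ≤ 3 by norm_num), Real.sqrt_nonneg 3]
  calc (2 * (sharpConstant * (n : ℝ) ^ (3 / 4 : ℝ) + 6 * Real.sqrt n + 5) +
          (7 * Real.sqrt 3 + 18) * Real.sqrt n + 56) / n + 2 / Real.sqrt n
      = 2 * sharpConstant * ((n : ℝ) ^ (3 / 4 : ℝ) / n) + (30 + 7 * Real.sqrt 3) * (Real.sqrt n / n) +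
          2 * (Real.sqrt n)⁻¹ + 66 * (1 / n) := by
        field_simp
        ring
    _ = 2 * sharpConstant * t + (32 + 7 * Real.sqrt 3) * t ^ 2 + 66 * (1 / n) := by
        rw [e1, hsn, e2]; ring
    _ ≤ 2 * sharpConstant * t + (32 + 7 * Real.sqrt 3) * t ^ 2 + 66 * t ^ 2 := by gcongr
    _ ≤ 2 * sharpConstant * t + 113 * t * t := by
        nlinarith [mul_nonneg (sub_nonneg.2 h73) (sq_nonneg t)]
    _ ≤ 2 * sharpConstant * t + δ * t := by gcongr
    _ = (2 * sharpConstant + δ) * t := by ring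

/-! ## §3 The named fact -/

/-- **Davoli–Piovano–Stefanelli 2017, Theorem 1.2 PROVED** (all three clauses of the named fact:
weak* convergence to `(2/√3)χ_W`, the sharp `N^{3/4}` law (15), and the flat-norm rate (18) with
constant `2K_t`), with the translations `a_n = −(centre of a maximal hexagon of M_n)`.
[cite: DavoliPiovanoStefanelli2017, Theorem 1.2 (15), (18), (19) p. 632; §4.1 p. 653–655] -/
theorem DavoliPiovanoStefanelli2017_wulffShape_holds : DavoliPiovanoStefanelli2017_wulffShape := by
  intro M hM
  refine ⟨fun n => -hexCenter (M n), fun g hg h0 => weakStar_wulffHexagon M hM hg h0,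
    fun δ hδ => ?_, fun δ hδ => eventually_flatNorm_le M hM hδ⟩
  filter_upwards [eventually_card_sub_card_maxHexagon_le hδ, Filter.eventually_ge_atTop 1] with n h hn
  exact h (M n) (hM n hn).1 (hM n hn).2

/-- **The flat-norm bound in closed form**: for `n ≥ 1`,
`(2E_n + (7√3+18)√n + 56)/n + 2/√n ≤ (2K_t + 113) n^{−1/4}`. [cite: DavoliPiovanoStefanelli2017, Theorem 1.2 (18) p. 632] -/
theorem flatBound_le {n : ℕ} (hn : 1 ≤ n) :
    (2 * (sharpConstant * (n : ℝ) ^ (3 / 4 : ℝ) + 6 * Real.sqrt n + 5) +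
          (7 * Real.sqrt 3 + 18) * Real.sqrt n + 56) / n + 2 / Real.sqrt n ≤
      (2 * sharpConstant + 113) * (n : ℝ) ^ (-(1 / 4 : ℝ)) := by
  have hn' : (0 : ℝ) < n := by exact_mod_cast hn
  have hs : 0 < Real.sqrt n := Real.sqrt_pos.2 hn'
  have hK0 : 0 ≤ sharpConstant := by unfold sharpConstant; positivity
  have hn0 : (n : ℝ) ≠ 0 := hn'.ne'
  have hs0 : Real.sqrt n ≠ 0 := hs.ne'
  set t : ℝ := (n : ℝ) ^ (-(1 / 4 : ℝ)) with ht
  have ht0 : 0 < t := Real.rpow_pos_of_pos hn' _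
  have ht1 : t ≤ 1 := Real.rpow_le_one_of_one_le_of_nonpos (by exact_mod_cast hn) (by norm_num)
  have e1 : (n : ℝ) ^ (3 / 4 : ℝ) / n = t := by
    rw [div_eq_iff hn0, ht, ← Real.rpow_add_one hn0]; norm_num
  have e2 : (Real.sqrt n)⁻¹ = t ^ 2 := by
    rw [ht, ← Real.rpow_natCast, ← Real.rpow_mul hn'.le, Real.sqrt_eq_rpow, ← Real.rpow_neg hn'.le]
    norm_num
  have hsn : Real.sqrt n / n = t ^ 2 := by rw [Real.sqrt_div_self, e2]
  have hs1 : 1 ≤ Real.sqrt n := by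
    rw [← Real.sqrt_one]; exact Real.sqrt_le_sqrt (by exact_mod_cast hn)
  have hs_le_n : Real.sqrt n ≤ n := by
    have h := Real.mul_self_sqrt hn'.le
    nlinarith
  have h1n : (1 : ℝ) / n ≤ t ^ 2 := by
    rw [← e2, one_div]; exact inv_anti₀ hs hs_le_n
  have h73 : 7 * Real.sqrt 3 ≤ 15 := by
    nlinarith [Real.sq_sqrt (show (0 : ℝ) ≤ 3 by norm_num), Real.sqrt_nonneg 3]
  calc (2 * (sharpConstant * (n : ℝ) ^ (3 / 4 : ℝ) + 6 * Real.sqrt n + 5) +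
          (7 * Real.sqrt 3 + 18) * Real.sqrt n + 56) / n + 2 / Real.sqrt n
      = 2 * sharpConstant * ((n : ℝ) ^ (3 / 4 : ℝ) / n) + (30 + 7 * Real.sqrt 3) * (Real.sqrt n / n) +
          2 * (Real.sqrt n)⁻¹ + 66 * (1 / n) := by
        field_simp
        ring
    _ = 2 * sharpConstant * t + (32 + 7 * Real.sqrt 3) * t ^ 2 + 66 * (1 / n) := by
        rw [e1, hsn, e2]; ring
    _ ≤ 2 * sharpConstant * t + (32 + 7 * Real.sqrt 3) * t ^ 2 + 66 * t ^ 2 := by gcongr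
    _ ≤ 2 * sharpConstant * t + 113 * t * t := by
        nlinarith [mul_nonneg (sub_nonneg.2 h73) (sq_nonneg t)]
    _ ≤ 2 * sharpConstant * t + 113 * t := by nlinarith
    _ = (2 * sharpConstant + 113) * t := by ring

end Literature.MathematicalPhysics.StatisticalMechanics.DavoliPiovanoStefanelli2017

/-! ## §4 Schmidt 2013, Theorem 2.4 PROVED: the flat-norm rate for sticky-disc ground states on the
lattice -/

namespace Literature.MathematicalPhysics.StatisticalMechanics.Schmidt2013

open AuYeungFrieseckeSchmidt2012 (wulffHexagon empiricalIntegral)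
open DavoliPiovanoStefanelli2017 (IsTriMinimizer setEmpiricalIntegral hexCenter flatNorm_le flatBound_le
  isTriMinimizer_image_triPoint_iff sharpConstant)
open Theil2006 (Plane triPoint triangularLattice triPoint_injective)
open Literature.Geometry.DiscreteGeometry (contactPairCount harborthNumber IsMaximalDiscConfig
  two_mul_contactPairCount_triPoint exists_contactPairCount_eq_harborthNumber)
open Literature.Geometry.DiscreteGeometry.HarborthSpiral (adjCount)

/-- **A sticky-disc ground state on the lattice is an EIP minimizer** (its label set attains
Harborth's bound): the centre set `{x_i}` of a maximal hard configuration contained in `𝓛` is a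
minimizer of the edge-isoperimetric problem. [cite: Schmidt2013, Theorem 2.1 and §2 (p0005–p0007)]
[cite: DavoliPiovanoStefanelli2017, (10)–(12) p. 630] -/
theorem isTriMinimizer_of_isMaximalDiscConfig {N : ℕ} {x : Fin N → Plane} (hx : IsMaximalDiscConfig x)
    (hlat : ∀ i, x i ∈ triangularLattice) : IsTriMinimizer (Finset.univ.image x) := by
  classical
  choose c hc using fun i => hlat i
  have hxc : x = fun i => triPoint (c i) := funext fun i => (hc i).symm
  have hinj : Function.Injective x := by
    intro i j h
    by_contra hij
    have : 1 ≤ dist (x i) (x j) := hx.1 hij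
    rw [h, dist_self] at this
    linarith
  have hcinj : Function.Injective c := fun i j h => hinj (by rw [hxc]; simp [h])
  have himg : Finset.univ.image x = (Finset.univ.image c).image triPoint := by
    rw [Finset.image_image, hxc]; rfl
  rw [himg, isTriMinimizer_image_triPoint_iff, Finset.card_image_of_injective _ hcinj, Finset.card_univ,
    Fintype.card_fin, ← two_mul_contactPairCount_triPoint c hcinj, ← hxc]
  obtain ⟨y, hy, hyc⟩ := exists_contactPairCount_eq_harborthNumber N
  have := hx.2 y hy
  push_cast
  linarith [show (contactPairCount y : ℤ) ≤ contactPairCount x by exact_mod_cast this]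

/-- The empirical integral of the labelled configuration is the empirical integral of its (finset)
centre set. [cite: Schmidt2013, (1.3) (p0003)] -/
theorem empiricalIntegral_eq_setEmpiricalIntegral {N : ℕ} {x : Fin N → Plane}
    (hinj : Function.Injective x) (a : Plane) (φ : Plane → ℝ) :
    empiricalIntegral (fun i => x i + a) φ =
      setEmpiricalIntegral ((Finset.univ.image x).image fun y => y + a) φ := by
  classical
  unfold empiricalIntegral setEmpiricalIntegral
  rw [Finset.image_image, Finset.card_image_of_injective _ ((add_left_injective a).comp hinj),
    Finset.card_univ, Fintype.card_fin,
    Finset.sum_image fun i _ j _ h => ((add_left_injective a).comp hinj) h]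
  rfl

/-- **Schmidt 2013, Theorem 2.4 PROVED** (`‖μ_N − ρ₀ χ_h‖ ≤ C N^{−1/4}` for ground states on the
lattice, after a translation), with the explicit constant `C = 2K_t + 113 = 4/3^{1/4} + 113` and
threshold `N₀ = 13`, via Davoli–Piovano–Stefanelli's flat-norm estimate `flatNorm_le`.
[cite: Schmidt2013, Theorem 2.4 (p0007); (1.4) (p0003)] [cite: DavoliPiovanoStefanelli2017, Theorem 1.2 (18) p. 632] -/
theorem Schmidt2013_deviationUpperBound_holds : Schmidt2013_deviationUpperBound := by
  classical
  refine ⟨2 * sharpConstant + 113, 13, fun N hN x hx hlat => ?_⟩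
  have hinj : Function.Injective x := by
    intro i j h
    by_contra hij
    have : 1 ≤ dist (x i) (x j) := hx.1 hij
    rw [h, dist_self] at this
    linarith
  set M := Finset.univ.image x with hM
  have hmin : IsTriMinimizer M := isTriMinimizer_of_isMaximalDiscConfig hx hlat
  have hcard : M.card = N := by
    rw [hM, Finset.card_image_of_injective _ hinj, Finset.card_univ, Fintype.card_fin]
  refine ⟨-hexCenter M, ?_⟩
  have e : (fun φ : Plane → ℝ => empiricalIntegral (fun i => x i + -hexCenter M) φ -
      2 / Real.sqrt 3 * ∫ y in wulffHexagon, φ y) =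
      fun φ => setEmpiricalIntegral (M.image fun y => y + -hexCenter M) φ -
        2 / Real.sqrt 3 * ∫ y in wulffHexagon, φ y := by
    funext φ
    rw [empiricalIntegral_eq_setEmpiricalIntegral hinj]
  rw [e]
  exact (flatNorm_le hN hmin hcard).trans (flatBound_le (by omega))

end Literature.MathematicalPhysics.StatisticalMechanics.Schmidt2013

/-! ## §5 Au Yeung–Friesecke–Schmidt 2012, Theorem 1.2 PROVED: crystallization in the Wulff shape -/

namespace Literature.MathematicalPhysics.StatisticalMechanics.AuYeungFrieseckeSchmidt2012

open DavoliPiovanoStefanelli2017 (IsTriMinimizer setEmpiricalIntegral hexCenter weakStar_wulffHexagon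
  isTriMinimizer_image_triPoint_iff)
open Schmidt2013 (empiricalIntegral_eq_setEmpiricalIntegral)
open Theil2006 (Plane triPoint triangularLattice triPoint_injective)
open Literature.Geometry.DiscreteGeometry (contactPairCount harborthNumber
  two_mul_contactPairCount_triPoint exists_injective_contactPairCount_eq_harborthNumber
  pairwise_one_le_dist_triPoint)
open Literature.Geometry.DiscreteGeometry.HarborthSpiral (adjCount)

variable {N : ℕ}

/-- The energy (1.1) is invariant under rigid motions. [cite: AuYeungFrieseckeSchmidt2012, §1 (1.1) (p0003)] -/
theorem energy_isometry (V : ℝ → ℝ) (x : Fin N → Plane) (R : Plane ≃ₗᵢ[ℝ] Plane) (a : Plane) :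
    energy V (fun i => R (x i) + a) = energy V x := by
  unfold energy localEnergy
  simp only [dist_add_right, LinearIsometryEquiv.dist_map]

/-- **A crystallized ground state is an EIP minimizer**: if `V` satisfies (H1)–(H3), `x` is a ground
state of `E = Σ_{i≠j} V(|x_i − x_j|)` and the moved configuration `R x + a` lies on `𝓛`, then the centre
set of `R x + a` attains Harborth's bound (compare with the hexagonal spiral, a lattice configuration of
energy `−2[3N − √(12N−3)]`). [cite: AuYeungFrieseckeSchmidt2012, §2 (2.8)–(2.10) (p0005); §5 (p0012)] -/
theorem isTriMinimizer_of_isGroundState {V : ℝ → ℝ} {α β : ℝ} (hV : IsShortRangePotential V α β)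
    {x : Fin N → Plane} (hx : IsGroundState V α x) {R : Plane ≃ₗᵢ[ℝ] Plane} {a : Plane}
    (hlat : ∀ i, R (x i) + a ∈ triangularLattice) :
    IsTriMinimizer (Finset.univ.image fun i => R (x i) + a) ∧
      Function.Injective (fun i => R (x i) + a) := by
  classical
  choose c hc using fun i => hlat i
  have hinjx : Function.Injective x := by
    intro i j h
    by_contra hij
    have : α ≤ dist (x i) (x j) := hx.1 hij
    rw [h, dist_self] at this
    linarith [hV.alpha_pos]
  have hinj : Function.Injective (fun i => R (x i) + a) := fun i j h =>
    hinjx (R.injective (add_right_cancel h))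
  have hyc : (fun i => R (x i) + a) = fun i => triPoint (c i) := funext fun i => (hc i).symm
  have hcinj : Function.Injective c := fun i j h => hinj (by rw [hyc]; simp [h])
  refine ⟨?_, hinj⟩
  have himg : (Finset.univ.image fun i => R (x i) + a) = (Finset.univ.image c).image triPoint := by
    rw [Finset.image_image, hyc]; rfl
  rw [himg, isTriMinimizer_image_triPoint_iff, Finset.card_image_of_injective _ hcinj, Finset.card_univ,
    Fintype.card_fin, ← two_mul_contactPairCount_triPoint c hcinj]
  -- compare with the hexagonal spiral
  obtain ⟨c', hc', hcount⟩ := exists_injective_contactPairCount_eq_harborthNumber N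
  have hadm : IsAdmissible α (fun i => triPoint (c' i)) := fun i j hij =>
    hV.alpha_le_one.trans (pairwise_one_le_dist_triPoint hc' hij)
  have hle := hx.2 _ hadm
  rw [← energy_isometry V x R a, hyc, energy_triPoint_eq hV hcinj, energy_triPoint_eq hV hc'] at hle
  have : (harborthNumber N : ℝ) ≤ contactPairCount (fun i => triPoint (c i)) := by
    have e : ((contactPairCount fun i => triPoint (c' i) : ℕ) : ℝ) = (harborthNumber N : ℝ) := by
      exact_mod_cast hcount
    linarith
  have : harborthNumber N ≤ (contactPairCount (fun i => triPoint (c i)) : ℤ) := by exact_mod_cast this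
  push_cast
  linarith

/-- `∫ g d(ρ χ_h) = (2/√3) ∫_h g`. [cite: AuYeungFrieseckeSchmidt2012, Theorem 1.2 (p0004)] -/
theorem integral_clusterMeasure (E : Set Plane) (g : Plane → ℝ) :
    ∫ y, g y ∂(clusterMeasure E) = 2 / Real.sqrt 3 * ∫ y in E, g y := by
  unfold clusterMeasure
  rw [integral_smul_measure, ENNReal.toReal_ofReal (by positivity), smul_eq_mul]

/-- **Au Yeung–Friesecke–Schmidt 2012, Theorem 1.2 (crystallization in the Wulff shape) PROVED**: the
named fact `AuYeungFrieseckeSchmidt2012_wulffShape` holds — rotations from Definition 1.1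
(crystallized ground states), translations `a_N − q_N` with `q_N` the centre of a maximal hexagon,
and the weak* limit from `weakStar_wulffHexagon` (Davoli–Piovano–Stefanelli's route).
[cite: AuYeungFrieseckeSchmidt2012, Theorem 1.2 (p0004); §5 (p0012)] -/
theorem AuYeungFrieseckeSchmidt2012_wulffShape_holds : AuYeungFrieseckeSchmidt2012_wulffShape := by
  classical
  intro V α β hV hcr x hx
  choose R₀ a₀ hdet hlat using fun N => (hcr N).2 (x N) (hx N)
  set M : ℕ → Finset Plane := fun N => Finset.univ.image fun i => R₀ N (x N i) + a₀ N with hMdef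
  have hgs := fun N => isTriMinimizer_of_isGroundState hV (hx N) (hlat N)
  have hM : ∀ n, 1 ≤ n → IsTriMinimizer (M n) ∧ (M n).card = n := fun n _ =>
    ⟨(hgs n).1, by rw [hMdef]; dsimp only; rw [Finset.card_image_of_injective _ (hgs n).2,
      Finset.card_univ, Fintype.card_fin]⟩
  refine ⟨R₀, fun N => a₀ N + -hexCenter (M N), hdet, fun g hg h0 => ?_⟩
  have hlim := weakStar_wulffHexagon M hM hg h0
  rw [integral_clusterMeasure]
  refine hlim.congr' (Eventually.of_forall fun N => ?_)
  have e : (fun i => R₀ N (x N i) + (a₀ N + -hexCenter (M N))) =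
      fun i => (R₀ N (x N i) + a₀ N) + -hexCenter (M N) := funext fun i => (add_assoc _ _ _).symm
  show _ = empiricalIntegral (fun i => R₀ N (x N i) + (a₀ N + -hexCenter (M N))) g
  rw [e, empiricalIntegral_eq_setEmpiricalIntegral (hgs N).2]

/-- **Corollary (unconditional now): the sticky disc crystallizes in the Wulff shape** — for every
sequence of maximal contact configurations of `N` unit discs there are rotations and translations
such that the re-scaled empirical measures converge weak* to `(2/√3)χ_h`.
[cite: AuYeungFrieseckeSchmidt2012, Theorem 1.2 (p0004)] -/
theorem wulffShape_stickyPotential_holds (x : (N : ℕ) → (Fin N → Plane))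
    (hx : ∀ N, Literature.Geometry.DiscreteGeometry.IsMaximalDiscConfig (x N)) :
    ∃ (R : ℕ → (Plane ≃ₗᵢ[ℝ] Plane)) (a : ℕ → Plane),
      (∀ N, LinearMap.det ((R N).toLinearEquiv : Plane →ₗ[ℝ] Plane) = 1) ∧
      WeakStarTo (fun N => N) (fun N i => R N (x N i) + a N) (clusterMeasure wulffHexagon) :=
  wulffShape_stickyPotential AuYeungFrieseckeSchmidt2012_wulffShape_holds x hx

end Literature.MathematicalPhysics.StatisticalMechanics.AuYeungFrieseckeSchmidt2012
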